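import Summits.QuantumFields.YangMills.Theorems.PoincareLipschitzHSystemGapAtThreePiOfDoors
import Summits.QuantumFields.YangMills.Theorems.PoincareLipschitzWenteTwoPointOfRows
import Summits.QuantumFields.YangMills.Theorems.PoincareLipschitzWenteOneCentre
import Summits.QuantumFields.YangMills.Theorems.PoincareLipschitzSobolevInversionWente
import Summits.QuantumFields.YangMills.Theorems.PoincareLipschitzSobolevPlanarDecay
import HarnessLib

/-!
# Crux `BlockLipschitzL` (stmt-QuantumFields-23533) ∕ `HistoryTailL` (stmt-QuantumFields-19936), LINE 25 «CompactnessTransfer»,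
# stub S1″ — the (GAP) socket, ROAD (W) «Wente at 3π»: THE CLOSING FILE — THE `H`-SYSTEM ENERGY GAP AT `3π`, HYPOTHESIS-FREE

Cell `ym3-torus` (YM ladder rung R3 = continuum SU(2) Yang–Mills on T³ — a RUNG, NOT Clay: not d = 4, not infinite volume,
not a mass gap); WIDTH helper seat `ym-ust-19936-w3` g16 (road owner of ROAD (W)); `--supports stmt-QuantumFields-23533`;
THEOREMS ONLY (0 `def`, 0 `sorry`, default heartbeats).

WHAT THIS FILE PROVES (two `exact`s over the road's landed bricks):
* ★★★ `doorTWO_holds` — THE SHARP TWO-POINT WENTE BOUND for scalar configurations `(u; a, b)` on `ℝ²` (`Δu = 2 det(∇a,∇b)` weakly in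
  `W^{1,2}_loc ∩ L²_loc` with finite energies): `u` a.e. equals a continuous `ū` with `|ū x₀ − ū x₁| ≤ (1∕π)‖∇a‖₂‖∇b‖₂` for ALL `x₀, x₁`
  (Wente 1969 ∕ Brezis–Coron ∕ Topping's constant `1∕2π`, in oscillation form) := ✓`…WenteTwoPointOfRows.doorTWO_of_rows` fed with
  w7 g15's ✓`…WenteOneCentre.wente_oneCentre` (one-centre bound by radial test functions, the weak Jacobian identity, Wirtinger on
  circles — px6 g10's ✓`…CircleWirtinger`), w4 g16's ✓`…SobolevInversion.wenteTriple_comp_inversion` (conformal transport under the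
  planar inversion, removable pole) and px22 g8's ✓`…SobolevPlanarDecay.integrableOn_sq_div_norm_pow_four` (planar decay of
  finite-energy Sobolev functions), through px22 g8's ✓`…WenteTwoPoint.wente_twoPoint_of_oneCentre_of_inversion`.
* ★★★ `hSystem_energy_zero_of_le_three_pi` — THE SOCKET OF RECORD: for `B : ℝ² → ℝ³` with weak gradient `GB` on `ℝ²` (i),
  `B ∈ L²_loc` (i′), integrable energy density (ii) and the weak `H`-system `ΔB = 2 B_x ∧ B_y` (iii) — rows (i)(ii)(iii) being those of
  `Literature.Analysis.PDE.HSystemEnergyQuantization` VERBATIM — `∫Σ_k‖GB e_k‖² ≤ 3π ⇒ ∫Σ_k‖GB e_k‖² = 0` := ✓`…OfDoors.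
  hSystem_energy_zero_of_le_three_pi_of_doorTWO doorTWO_holds` (inside: px3 g10's ✓`…HSystemEnergyIdentity.energy_le_abs` and the
  algebraic knit ✓`…HSystemGapAlgebra.energy_zero_of_osc_of_energyBound` — cubic chain + equality case at exactly `3π`).
This is the elementary replacement, below `3π`, of the named fact [BrezisCoron1985, App. Lemma A.1] (`∫|∇B|² ∈ 8πℕ`) on ROAD (H):
px19 g8's closer consumes it in place of `(hF : HSystemEnergyQuantization)`.

HONEST SCOPE.  A theorem about finite-energy weak `H`-system solutions on the plane; it does NOT by itself prove (GAP) (that needs the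
cone → link transport (T), the quaternionic currents (Q) and the stream functions (H) of ROAD (H)), nor S1″, `BlockLipschitzL`,
`HistoryTailL`, nor anything at d = 4.  YM₃ on T³ is rung R3, not Clay; YM gap NOT proved; no summit statement is proved here.

References: H. Wente, J. Math. Anal. Appl. 26 (1969); H. Brezis, J.-M. Coron, ARMA 89 (1985) [BrezisCoron1985]; P. Topping,
Comment. Math. Helv. 72 (1997) [Topping1997]; F. Hélein (2002) [Helein2002] §3.1.
-/

set_option autoImplicit false

noncomputable section

open MeasureTheory Set Function Filter Topology TopologicalSpace EuclideanGeometry Metric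
open scoped ContDiff BigOperators

namespace Summit.QuantumFields.YangMills.Theorems.PoincareLipschitzHSystemGapAtThreePi

open Literature.Analysis.FunctionSpaces
open Summit.QuantumFields.YangMills.Theorems

/-- ★★★ **The sharp two-point Wente bound, hypothesis-free** (DOOR-TWO of ROAD (W)): for a scalar configuration `(u; a, b)` on
`ℝ²` — `u, a, b ∈ W^{1,2}_loc ∩ L²_loc` with square-integrable weak gradients and `−∫Σ_k ∂_kη ∂_ku = 2∫ η det(∇a, ∇b)` for all test
functions — `u` agrees a.e. with a continuous `ū` satisfying `|ū x₀ − ū x₁| ≤ (1∕π)‖∇a‖₂‖∇b‖₂` for all `x₀, x₁`.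
[cite: Topping1997, Theorem 1 (the constant 1∕2π = 1∕4π·‖∇(a,b)‖² after scaling); BrezisCoron1985, Appendix Lemma A.1 (p. 48: inversion and removable pole)] -/
theorem doorTWO_holds :
    ∀ (u a b : EuclideanSpace ℝ (Fin 2) → ℝ)
      (Gu Ga Gb : EuclideanSpace ℝ (Fin 2) → (EuclideanSpace ℝ (Fin 2) →L[ℝ] ℝ)),
      HasWeakFDerivOn ⟨Set.univ, isOpen_univ⟩ volume u Gu →
      HasWeakFDerivOn ⟨Set.univ, isOpen_univ⟩ volume a Ga →
      HasWeakFDerivOn ⟨Set.univ, isOpen_univ⟩ volume b Gb →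
      LocallyIntegrable (fun y => u y ^ 2) volume →
      LocallyIntegrable (fun y => a y ^ 2) volume →
      LocallyIntegrable (fun y => b y ^ 2) volume →
      Integrable (fun y => ∑ k : Fin 2, (Gu y (EuclideanSpace.single k (1:ℝ))) ^ 2) volume →
      Integrable (fun y => ∑ k : Fin 2, (Ga y (EuclideanSpace.single k (1:ℝ))) ^ 2) volume →
      Integrable (fun y => ∑ k : Fin 2, (Gb y (EuclideanSpace.single k (1:ℝ))) ^ 2) volume →
      (∀ η : EuclideanSpace ℝ (Fin 2) → ℝ, ContDiff ℝ ∞ η → HasCompactSupport η →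
        -(∫ y, ∑ k : Fin 2, fderiv ℝ η y (EuclideanSpace.single k (1:ℝ)) * Gu y (EuclideanSpace.single k (1:ℝ))) =
          2 * ∫ y, η y * (Ga y (EuclideanSpace.single 0 (1:ℝ)) * Gb y (EuclideanSpace.single 1 (1:ℝ)) -
            Ga y (EuclideanSpace.single 1 (1:ℝ)) * Gb y (EuclideanSpace.single 0 (1:ℝ)))) →
      ∃ ū : EuclideanSpace ℝ (Fin 2) → ℝ, Continuous ū ∧ ū =ᵐ[volume] u ∧
        ∀ x₀ x₁, |ū x₀ - ū x₁| ≤ 1 / Real.pi *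
          (Real.sqrt (∫ y, ∑ k : Fin 2, (Ga y (EuclideanSpace.single k (1:ℝ))) ^ 2) *
           Real.sqrt (∫ y, ∑ k : Fin 2, (Gb y (EuclideanSpace.single k (1:ℝ))) ^ 2)) :=
  PoincareLipschitzWenteTwoPointOfRows.doorTWO_of_rows
    PoincareLipschitzWenteOneCentre.wente_oneCentre
    (fun c _ _ _ _ _ _ hu ha hb hu2 ha2 hb2 hGu hGa hGb hEq hdu hda hdb =>
      PoincareLipschitzSobolevInversion.wenteTriple_comp_inversion c hu ha hb hu2 ha2 hb2 hGu hGa hGb hEq hdu hda hdb)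
    (fun hv hv2 hGv c => PoincareLipschitzSobolevPlanarDecay.integrableOn_sq_div_norm_pow_four hv hv2 hGv c)

/-- ★★★ **The `H`-system energy gap at `3π` (socket of record of ROAD (W), hypothesis-free)**: if `B : ℝ² → ℝ³` has a weak gradient
`GB` on `ℝ²`, lies in `L²_loc`, has integrable energy density `Σ_k‖GB e_k‖²`, and solves the `H`-system `ΔB = 2 B_x ∧ B_y` in the
`W^{1,2}`-weak sense (rows (i)(ii)(iii) of `Literature.Analysis.PDE.HSystemEnergyQuantization`), then
`∫Σ_k‖GB e_k‖² ≤ 3π ⇒ ∫Σ_k‖GB e_k‖² = 0`.  Elementary (sharp two-point Wente + energy identity + cubic chain with the equality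
case); replaces the Brezis–Coron 8π-quantisation below 3π. [cite: BrezisCoron1985, Appendix Lemma A.1 (replaced below 3π); Topping1997, Theorem 1] -/
theorem hSystem_energy_zero_of_le_three_pi
    {B : EuclideanSpace ℝ (Fin 2) → EuclideanSpace ℝ (Fin 3)}
    {GB : EuclideanSpace ℝ (Fin 2) → (EuclideanSpace ℝ (Fin 2) →L[ℝ] EuclideanSpace ℝ (Fin 3))}
    (hB : HasWeakFDerivOn ⟨Set.univ, isOpen_univ⟩ volume B GB)
    (hB2 : LocallyIntegrable (fun y => ‖B y‖ ^ 2) volume)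
    (hE : Integrable (fun y => ∑ k : Fin 2, ‖GB y (EuclideanSpace.single k (1:ℝ))‖ ^ 2) volume)
    (hH : ∀ (η : EuclideanSpace ℝ (Fin 2) → ℝ), ContDiff ℝ ∞ η → HasCompactSupport η → ∀ a : Fin 3,
      -(∫ y, ∑ k : Fin 2, fderiv ℝ η y (EuclideanSpace.single k (1:ℝ)) * (GB y (EuclideanSpace.single k (1:ℝ))) a) =
        2 * ∫ y, η y * ((GB y (EuclideanSpace.single 0 (1:ℝ))) (a + 1) * (GB y (EuclideanSpace.single 1 (1:ℝ))) (a + 2) -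
          (GB y (EuclideanSpace.single 0 (1:ℝ))) (a + 2) * (GB y (EuclideanSpace.single 1 (1:ℝ))) (a + 1)))
    (hΘ : ∫ y, ∑ k : Fin 2, ‖GB y (EuclideanSpace.single k (1:ℝ))‖ ^ 2 ≤ 3 * Real.pi) :
    ∫ y, ∑ k : Fin 2, ‖GB y (EuclideanSpace.single k (1:ℝ))‖ ^ 2 = 0 :=
  PoincareLipschitzHSystemGapAtThreePiOfDoors.hSystem_energy_zero_of_le_three_pi_of_doorTWO doorTWO_holds hB hB2 hE hH hΘ

end Summit.QuantumFields.YangMills.Theorems.PoincareLipschitzHSystemGapAtThreePi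

end
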